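import Summits.BirchSwinnertonDyer.BirchSwinnertonDyer.Theorems.ErratumRoadFiveIMCDivRoadFFFittingFrameBOfWeakFacts
import Literature.NumberTheory.EllipticCurves.SkinnerUrban2014.CofinitelyGeneratedSelmerProofs
import HarnessLib

/-!
# K2 crux `IMCDivAtErratumDataAllR` (item stmt-BirchSwinnertonDyer-20169), ROAD FF — the DECIDING stub
# `stub_roadFF_fittingCongruenceFrameB` from TWO named facts: the erratum's member package (torsion-free premise
# form, OPEN) and Shapiro ([SU14] Prop. 3.2.3, PUB) — [SU14] Lemma 3.1.9 is now a THEOREM of the tree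

Cell `bsd-stepL` (run/shared/lean/pub/bsd-stepL/), seat `bsd-stepL-imc-p1` (prover g11, 2026-08-27);
`--supports stmt-BirchSwinnertonDyer-20169 --as helper`; Theses-free (usable inside a route-level `closes`).

## What this file proves

Sequel of `Theorems/ErratumRoadFiveIMCDivRoadFFFittingFrameBOfWeakFacts.lean` (same seat, p524987:
`P2.RoadFF.fittingCongruenceFrameAtErratumDataB_of_weak_facts (hMem) (hSh) (hFG)`), discharging its binder
`hFG : SkinnerUrban2014.lemma319_finite_XBig` by the tree's theorem `SkinnerUrban2014.lemma319_finite_XBig_holds`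
(`Literature/…/SkinnerUrban2014/CofinitelyGeneratedSelmerProofs.lean`, bsd-stepL defn-ty1 g4, p523055, 2026-08-27):

* **`P2.RoadFF.fittingCongruenceFrameAtErratumDataB_of_members_of_prop323`** — the REGISTERED deciding-stub signature
  `∀ W p, P2.RoadFF.FittingCongruenceFrameAtErratumDataB W p Σ(·) P_Σ(·)` of skeleton
  `Cruxes/IMCDivAtErratumDataAllR/Lines/birth.lean` from exactly TWO named facts:
  (OPEN, claim-tagged, UNREFEREED) `Castella2018.erratum_members_exists_charIdeal_le_of_isTorsion_congruence_OPEN`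
  (the erratum's member package WITHOUT Thm. 2.3's torsion clause: frame of `f` [Cas18 Thm. 3.1], Hida members (a)(b)
  [Ski16 §2.6], (2.5)_m via [FW21, Thm. 4.41] under the torsion premise, (c) [Cas20 Thm. 2.11]) and
  (PUB) `SkinnerUrban2014.prop323_XAc_equiv_XBigDecomp` (Shapiro, [SU14] Prop. 3.2.3);
* **`P2.RoadFF.fittingCongruenceFrameAtErratumDataB_of_OPEN_of_prop323`** — the same from the member package of
  record O14 `Castella2018.erratum_members_exists_isTorsion_charIdeal_le_congruence_OPEN` (via the projection
  `….of_OPEN`), for a planner who keeps O14 registered.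

HONEST FRAMING: theorems only (no definition, no named fact minted here, no instance, no `sorry`); CONDITIONAL on
the two named facts, one of which (the member package, resting on the unrefereed erratum and arXiv:2107.13726
Thm. 4.41) is OPEN; nothing is booked; the anticyclotomic main conjecture is asserted nowhere; BSD is proved for no
pair; no census number moves (T7). Net effect of 2026-08-27 on crux 20169's Road-FF inputs: named facts
{prop332_…_of_noTamagawaDefect, GZK, exists_isNewformOf, prop323} (PUB) + ONE OPEN package free of GAP-β.

References: [Castella2018Erratum] (2.4)–(2.5), proof of Thm. 1.1 (pp. 3–4); [FouquetWan2021] Thm. 4.41 (PREPRINT);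
[SkinnerUrban2014] Prop. 3.2.3, Lemma 3.1.9 (p. 20); [Skinner2016PacificMC] §2.6, §3.1; [Castella2020JIMJ] Thm. 2.11;
[Castella2018] Thm. 3.1, (3.1).
-/

set_option autoImplicit false

noncomputable section

open scoped Classical
open WeierstrassCurve NumberField IsDedekindDomain
open Literature.NumberTheory.EllipticCurves Literature.NumberTheory.EllipticCurves.Castella2018

namespace Summit.BirchSwinnertonDyer.Rank1Residual.X11b

/-- **ROAD FF, DECIDING STUB `stub_roadFF_fittingCongruenceFrameB` OF CRUX `IMCDivAtErratumDataAllR` (item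
stmt-BirchSwinnertonDyer-20169) FROM TWO NAMED FACTS** — the erratum's member package in torsion-free premise form
(OPEN, claim-tagged) and Shapiro's lemma [SU14] Prop. 3.2.3 (PUB); [SU14] Lemma 3.1.9 enters as the tree's theorem
`SkinnerUrban2014.lemma319_finite_XBig_holds`. The conclusion is EXACTLY the registered signature
`∀ W p, P2.RoadFF.FittingCongruenceFrameAtErratumDataB W p Σ(·) P_Σ(·)`. CONDITIONAL; nothing is booked.
[claim: Castella2018Erratum, status: under-review] [claim: FouquetWan2021, status: under-review]
[cite: Castella2018Erratum, (2.4)–(2.5) and proof of Thm. 1.1 (pp. 3–4)] [cite: SkinnerUrban2014, Prop. 3.2.3 and Lemma 3.1.9 (p. 20)] -/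
theorem P2.RoadFF.fittingCongruenceFrameAtErratumDataB_of_members_of_prop323
    (hMem : erratum_members_exists_charIdeal_le_of_isTorsion_congruence_OPEN)
    (hSh : SkinnerUrban2014.prop323_XAc_equiv_XBigDecomp)
    (W : WeierstrassCurve ℚ) [W.IsElliptic] [W.IsGloballyMinimal] (p : ℕ) [Fact p.Prime] :
    P2.RoadFF.FittingCongruenceFrameAtErratumDataB W p
      (fun K _ _ ↦ (↑(W.sigmaPlacesFinset p K) : Set (HeightOneSpectrum (𝓞 K))))
      (fun K _ _ κ _ ↦ W.sigmaEulerElement p K κ) :=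
  P2.RoadFF.fittingCongruenceFrameAtErratumDataB_of_weak_facts hMem hSh SkinnerUrban2014.lemma319_finite_XBig_holds W p

/-- **The same from the member package of record O14** (`Castella2018.erratum_members_exists_isTorsion_charIdeal_le_congruence_OPEN`,
through the projection `….of_OPEN`) **and Shapiro** — two named facts, [SU14] Lemma 3.1.9 discharged. CONDITIONAL;
nothing is booked. [claim: Castella2018Erratum, status: under-review] [claim: FouquetWan2021, status: under-review]
[cite: SkinnerUrban2014, Prop. 3.2.3 and Lemma 3.1.9 (p. 20)] -/
theorem P2.RoadFF.fittingCongruenceFrameAtErratumDataB_of_OPEN_of_prop323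
    (hMem : erratum_members_exists_isTorsion_charIdeal_le_congruence_OPEN)
    (hSh : SkinnerUrban2014.prop323_XAc_equiv_XBigDecomp)
    (W : WeierstrassCurve ℚ) [W.IsElliptic] [W.IsGloballyMinimal] (p : ℕ) [Fact p.Prime] :
    P2.RoadFF.FittingCongruenceFrameAtErratumDataB W p
      (fun K _ _ ↦ (↑(W.sigmaPlacesFinset p K) : Set (HeightOneSpectrum (𝓞 K))))
      (fun K _ _ κ _ ↦ W.sigmaEulerElement p K κ) :=
  P2.RoadFF.fittingCongruenceFrameAtErratumDataB_of_members_of_prop323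
    (erratum_members_exists_charIdeal_le_of_isTorsion_congruence_OPEN.of_OPEN hMem) hSh W p

end Summit.BirchSwinnertonDyer.Rank1Residual.X11b

end
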